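import Literature.Computability.QuantumComplexity.SinkOfVerifiableLine
import Mathlib.GroupTheory.Perm.Basic

/-!
# Permutation instances of black-box SVL and output transpositions

Scaffolding for the ONE remaining target of the proof route of the crux
`WhiteBoxWalk.WbwVerifiableLineNoSpeedup` (stmt-QuantumAdvantage-2239; refuter work file
`Cruxes/WbwVerifiableLineNoSpeedup/Disproof.lean` §7.1, target `SvlAdversarySmallT`): the
instances `(S, V) = (σ, [x = σ^i 0])` of a permutation `σ` of the names (`permInput`), their line
`x_i = σ^i(0)` (`permLine`), the long-cycle condition `NoReturn T σ` (no point returns within `T`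
steps) and its consequence that the instance is in the promise with sink parity that of `σ^T(0)`
(`isSvlLine_permInput`, `svlSinkBit_permInput`), injectivity of the encoding, and the OUTPUT
TRANSPOSITION `transpose σ u v = σ * swap u v` of the adversary relation together with the prefix /
continuation lemmas for its line (`permLine_transpose_eq`, `permLine_transpose_succ`,
`permLine_transpose_add`: with `u = x_k` the new line agrees up to `k` and then reads
`σ v, σ² v, …` as long as the `σ`-orbit of `v` avoids `u, v`). What is NOT here: the four counts of
§7.1 (degrees `≥ T(N/2-2T-1)`, row count `≤ N+T`, acquire count `≤ 2T`, total `≤ TN`) and the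
closure of the long-cycle family under merges — the prover's remaining work, to be plugged into
`Negative.WeightedAdversary.weightedAdversaryBound_holds`. Sorry-free.
-/

noncomputable section

set_option linter.dupNamespace false

namespace Summit.QuantumAdvantage.QuantumAdvantage.Theorems.WbwVerifiableLineNoSpeedup.Negative.PermInstances

open Literature.Computability.Cryptography Literature.Computability.QuantumComplexity
  Literature.Computability.Complexity

variable {m T : ℕ}

/-- The source name `0`. [folklore] -/
def src0 (m : ℕ) : Fin (2 ^ m) := ⟨0, Nat.two_pow_pos m⟩

/-- The line of the permutation `σ`: `x_i = σ^i(0)`. [folklore] -/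
def permLine (T : ℕ) (σ : Equiv.Perm (Fin (2 ^ m))) (i : Fin (T + 1)) : Fin (2 ^ m) :=
  (σ ^ i.val) (src0 m)

/-- The SVL input of the permutation `σ`: `S = σ`, `V(x, i) = [x = σ^i(0)]`. [folklore] -/
def permInput (T : ℕ) (σ : Equiv.Perm (Fin (2 ^ m))) : SVLInput m T :=
  svlInput m T σ fun x i => decide (x = permLine T σ i)

/-- No point returns to itself within `T` steps (all cycles of `σ` are longer than `T`). [folklore] -/
def NoReturn (T : ℕ) (σ : Equiv.Perm (Fin (2 ^ m))) : Prop :=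
  ∀ x : Fin (2 ^ m), ∀ k : ℕ, 1 ≤ k → k ≤ T → (σ ^ k) x ≠ x

/-- Weaker: the source does not return within `T` steps (the line is simple). [folklore] -/
def NoReturnAtZero (T : ℕ) (σ : Equiv.Perm (Fin (2 ^ m))) : Prop :=
  ∀ k : ℕ, 1 ≤ k → k ≤ T → (σ ^ k) (src0 m) ≠ src0 m

/-- `NoReturn` implies `NoReturnAtZero`. [folklore] -/
theorem NoReturn.atZero {σ : Equiv.Perm (Fin (2 ^ m))} (h : NoReturn T σ) : NoReturnAtZero T σ :=
  fun k hk hkT => h _ k hk hkT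

/-- The line of `σ` is simple when the source does not return within `T` steps. [folklore] -/
theorem permLine_injective {σ : Equiv.Perm (Fin (2 ^ m))} (h : NoReturnAtZero T σ) :
    Function.Injective (permLine T σ) := by
  intro i j hij
  unfold permLine at hij
  by_contra hne
  rcases lt_or_gt_of_ne (fun h' => hne (Fin.ext h')) with hlt | hlt
  · -- σ^i 0 = σ^j 0 with i < j ⇒ σ^(j-i) 0 = 0
    have : (σ ^ (j.val - i.val)) (src0 m) = src0 m := by
      have e : σ ^ j.val = σ ^ i.val * σ ^ (j.val - i.val) := by
        rw [← pow_add]; congr 1; omega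
      rw [e, Equiv.Perm.mul_apply] at hij
      exact (σ ^ i.val).injective hij.symm
    exact h (j.val - i.val) (by omega) (by have := j.isLt; omega) this
  · have : (σ ^ (i.val - j.val)) (src0 m) = src0 m := by
      have e : σ ^ i.val = σ ^ j.val * σ ^ (i.val - j.val) := by
        rw [← pow_add]; congr 1; omega
      rw [e, Equiv.Perm.mul_apply] at hij
      exact (σ ^ j.val).injective hij
    exact h (i.val - j.val) (by omega) (by have := i.isLt; omega) this

/-- **Permutation instances are in the promise**, with line `permLine`. [folklore] -/
theorem isSvlLine_permInput {σ : Equiv.Perm (Fin (2 ^ m))} (h : NoReturnAtZero T σ) :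
    IsSvlLine (permInput T σ) (permLine T σ) := by
  rw [isSvlLine_iff]
  refine ⟨permLine_injective h, rfl, fun i => ?_, fun x i => ?_⟩
  · rw [permInput, svlSucc_svlInput]
    simp only [permLine, Fin.val_castSucc, Fin.val_succ, pow_succ', Equiv.Perm.mul_apply]
  · rw [permInput, svlVerify_svlInput]

/-- Hence permutation instances lie in the promise set. [folklore] -/
theorem permInput_mem {σ : Equiv.Perm (Fin (2 ^ m))} (h : NoReturnAtZero T σ) :
    permInput T σ ∈ svlPromise m T :=
  ⟨_, isSvlLine_permInput h⟩

/-- The sink bit of a permutation instance is the parity of `σ^T(0)`. [folklore] -/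
theorem svlSinkBit_permInput {σ : Equiv.Perm (Fin (2 ^ m))} (h : NoReturnAtZero T σ) :
    svlSinkBit m T (permInput T σ) = decide (((σ ^ T) (src0 m)).val % 2 = 1) := by
  rw [(isSvlLine_permInput h).svlSinkBit_eq]
  rfl

/-- Reading the tables back. [folklore] -/
theorem svlSucc_permInput (σ : Equiv.Perm (Fin (2 ^ m))) (x : Fin (2 ^ m)) :
    svlSucc (permInput T σ) x = σ x := by
  rw [permInput, svlSucc_svlInput]

/-- Reading the V-table back. [folklore] -/
theorem svlVerify_permInput (σ : Equiv.Perm (Fin (2 ^ m))) (x : Fin (2 ^ m)) (i : Fin (T + 1)) :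
    svlVerify (permInput T σ) x i = decide (x = permLine T σ i) := by
  rw [permInput, svlVerify_svlInput]

/-- `permInput` is injective (the S-table is the permutation). [folklore] -/
theorem permInput_injective : Function.Injective (permInput (m := m) T) := by
  intro σ τ h
  ext x
  have := congrArg (fun t => svlSucc t x) h
  simp only [svlSucc_permInput] at this
  rw [this]

/-- The output transposition of rows `u, v`: `σ' = σ * swap u v` (`σ'(u) = σ(v)`, `σ'(v) = σ(u)`). [folklore] -/
def transpose (σ : Equiv.Perm (Fin (2 ^ m))) (u v : Fin (2 ^ m)) : Equiv.Perm (Fin (2 ^ m)) :=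
  σ * Equiv.swap u v

/-- The transposed permutation sends `u` to `σ v`. [folklore] -/
theorem transpose_apply_left (σ : Equiv.Perm (Fin (2 ^ m))) (u v : Fin (2 ^ m)) :
    transpose σ u v u = σ v := by
  simp [transpose, Equiv.Perm.mul_apply, Equiv.swap_apply_left]

/-- The transposed permutation sends `v` to `σ u`. [folklore] -/
theorem transpose_apply_right (σ : Equiv.Perm (Fin (2 ^ m))) (u v : Fin (2 ^ m)) :
    transpose σ u v v = σ u := by
  simp [transpose, Equiv.Perm.mul_apply, Equiv.swap_apply_right]

/-- The transposed permutation agrees with `σ` off `{u, v}`. [folklore] -/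
theorem transpose_apply_of_ne (σ : Equiv.Perm (Fin (2 ^ m))) {u v x : Fin (2 ^ m)}
    (hu : x ≠ u) (hv : x ≠ v) : transpose σ u v x = σ x := by
  simp [transpose, Equiv.Perm.mul_apply, Equiv.swap_apply_of_ne_of_ne hu hv]

/-- Transposing twice restores `σ` (the relation is symmetric). [folklore] -/
theorem transpose_transpose (σ : Equiv.Perm (Fin (2 ^ m))) (u v : Fin (2 ^ m)) :
    transpose (transpose σ u v) u v = σ := by
  simp [transpose, mul_assoc, Equiv.swap_mul_self]

/-- **Prefix agreement**: if `u = x_k` and `v` avoids `x_0, …, x_{k-1}` (and `u` too, automatic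
for a simple line), the transposed permutation has the same line up to position `k`. [folklore] -/
theorem permLine_transpose_eq {σ : Equiv.Perm (Fin (2 ^ m))} {k : ℕ} {v : Fin (2 ^ m)}
    (hu : ∀ j < k, (σ ^ j) (src0 m) ≠ (σ ^ k) (src0 m))
    (hv : ∀ j < k, (σ ^ j) (src0 m) ≠ v) :
    ∀ j ≤ k, ((transpose σ ((σ ^ k) (src0 m)) v) ^ j) (src0 m) = (σ ^ j) (src0 m) := by
  intro j
  induction j with
  | zero => intro; rfl
  | succ j ih =>
    intro hj
    have hj' : j < k := by omega
    rw [pow_succ', Equiv.Perm.mul_apply, ih (by omega), pow_succ', Equiv.Perm.mul_apply]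
    exact transpose_apply_of_ne σ (hu j hj') (hv j hj')

/-- And at position `k + 1` it continues with `σ v`. [folklore] -/
theorem permLine_transpose_succ {σ : Equiv.Perm (Fin (2 ^ m))} {k : ℕ} {v : Fin (2 ^ m)}
    (hu : ∀ j < k, (σ ^ j) (src0 m) ≠ (σ ^ k) (src0 m))
    (hv : ∀ j < k, (σ ^ j) (src0 m) ≠ v) :
    ((transpose σ ((σ ^ k) (src0 m)) v) ^ (k + 1)) (src0 m) = σ v := by
  rw [pow_succ', Equiv.Perm.mul_apply, permLine_transpose_eq hu hv k le_rfl, transpose_apply_left]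

/-- **Iterates after the transposition (generic form)**: with `u = x_k`, if the `σ`-orbit of `v`
avoids `u` and `v` for the first `s` steps, then the new line reads `σ v, σ² v, …, σ^(s+1) v` at
positions `k+1, …, k+s+1`. (Merge type: `v` on another cycle — the hypothesis holds for all
`s < T` in the long-cycle family; split type: up to the wrap.) [folklore] -/
theorem permLine_transpose_add {σ : Equiv.Perm (Fin (2 ^ m))} {k : ℕ} {v : Fin (2 ^ m)}
    (hu : ∀ j < k, (σ ^ j) (src0 m) ≠ (σ ^ k) (src0 m))
    (hv : ∀ j < k, (σ ^ j) (src0 m) ≠ v) {s : ℕ}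
    (havoid : ∀ s', 1 ≤ s' → s' ≤ s → (σ ^ s') v ≠ (σ ^ k) (src0 m) ∧ (σ ^ s') v ≠ v) :
    ∀ s'', 1 ≤ s'' → s'' ≤ s + 1 →
      ((transpose σ ((σ ^ k) (src0 m)) v) ^ (k + s'')) (src0 m) = (σ ^ s'') v := by
  intro s''
  induction s'' with
  | zero => intro h; omega
  | succ s'' ih =>
    intro _ hs
    rcases Nat.eq_zero_or_pos s'' with rfl | hpos
    · simpa using permLine_transpose_succ hu hv
    · have hprev := ih hpos (by omega)
      rw [show k + (s'' + 1) = (k + s'') + 1 by ring, pow_succ', Equiv.Perm.mul_apply, hprev,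
        pow_succ', Equiv.Perm.mul_apply]
      obtain ⟨h1, h2⟩ := havoid s'' hpos (by omega)
      exact transpose_apply_of_ne σ h1 h2

/-- In the long-cycle family the simple-line hypotheses `hu` of the lemmas above hold for every
`k ≤ T`. [folklore] -/
theorem prefix_ne_of_noReturnAtZero {σ : Equiv.Perm (Fin (2 ^ m))} (h : NoReturnAtZero T σ)
    {k : ℕ} (hk : k ≤ T) : ∀ j < k, (σ ^ j) (src0 m) ≠ (σ ^ k) (src0 m) := by
  intro j hj heq
  have : (σ ^ (k - j)) (src0 m) = src0 m := by
    have e : σ ^ k = σ ^ j * σ ^ (k - j) := by rw [← pow_add]; congr 1; omega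
    rw [e, Equiv.Perm.mul_apply] at heq
    exact (σ ^ j).injective heq.symm
  exact h (k - j) (by omega) (by omega) this

end Summit.QuantumAdvantage.QuantumAdvantage.Theorems.WbwVerifiableLineNoSpeedup.Negative.PermInstances
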